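import Mathlib
import Summits.KontsevichZagierPeriods.Zeta5Search.TwoTaleOmega.OmegaForms
import Summits.KontsevichZagierPeriods.Zeta5Search.TwoTaleOmega.FormalBarnesKit

/-!
# (bmiss)@Ω — pole bookkeeping of the hinge data and the direction moves (instance kit, problem side)

HONEST FRAMING: systematic search; no irrationality claim unless certified. Pure finite algebra over `ℚ`; no named
fact, no `sorry`.

The per-direction instances of the Ω-recurrence (RECURRENCE.md §13.10–13.12) apply Lemma U (`PF.eq_of_eval_eq`) with an
explicit finite exceptional set `S`; for that they need WHERE the poles of the hinge data `vL p = dataR·Π⁻¹` and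
`vR p = ε·Π⁻¹·dataRT` lie, the degree bound of the polynomial part, and names for the five lattice moves
`p ↦ p + k·δ`. All of it is bookkeeping over `FormalBarnesLink.dataR`, `FormalBarnesTLink.dataRT`, `OmegaForms.Pt`.
-/

noncomputable section

open Finset Polynomial
open Literature.NumberTheory.Irrationality.Zudilin2014

namespace Summit.KontsevichZagierPeriods.Zeta5Search.FormalBarnes

/-! ### Supports of sums of singles -/

/-- The support of `Σ_{k ∈ S} single (φ k) (c k)` lies in `φ(S)`. -/
theorem support_sum_single_subset_image (S : Finset ℤ) (φ : ℤ → ℤ) (c : ℤ → ℚ) :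
    (∑ k ∈ S, Finsupp.single (φ k) (c k)).support ⊆ S.image φ := by
  intro j hj
  obtain ⟨k, hk, hjk⟩ := mem_biUnion.1 (Finsupp.support_finsetSum hj)
  have h := Finsupp.support_single_subset hjk
  rw [mem_singleton] at h
  exact mem_image.2 ⟨k, hk, h.symm⟩

/-- The support of `Σ_{k ∈ S} single k (c k)` lies in `S`. -/
theorem support_sum_single_subset (S : Finset ℤ) (c : ℤ → ℚ) :
    (∑ k ∈ S, Finsupp.single k (c k)).support ⊆ S := by
  simpa using support_sum_single_subset_image S id c

/-! ### Poles of `dataR`, `dataRT` -/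

/-- First-tale data have no double poles. -/
theorem dataR_double (a b : Fin 4 → ℤ) : (dataR a b).double = 0 := rfl

/-- The polynomial part of the first-tale data is `P`. -/
theorem dataR_poly (a b : Fin 4 → ℤ) : (dataR a b).poly = polyP a b := rfl

/-- The simple poles of the first-tale data sit at `a₄* ≤ k < b₄`. -/
theorem dataR_simple_support (a b : Fin 4 → ℤ) : (dataR a b).simple.support ⊆ Ico (amax a) (b 3) :=
  support_sum_single_subset _ _

/-- All poles of the first-tale data sit at `a₄* ≤ k < b₄`. -/
theorem poles_dataR (a b : Fin 4 → ℤ) : (dataR a b).poles ⊆ Ico (amax a) (b 3) := by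
  rw [PF.poles, dataR_double, Finsupp.support_zero, union_empty]
  exact dataR_simple_support a b

/-- Second-tale data have no polynomial part. -/
theorem dataRT_poly (a b : Fin 4 → ℤ) : (dataRT a b).poly = 0 := rfl

/-- The simple poles of the second-tale data (`u = 2t` convention) sit at the even integers `2k`, `aMid ≤ k < bMax`. -/
theorem dataRT_simple_support (a b : Fin 4 → ℤ) :
    (dataRT a b).simple.support ⊆ (Ico (aMid a) (bMax b)).image (fun k => 2 * k) :=
  support_sum_single_subset_image _ _ _

/-- The double poles of the second-tale data sit at the even integers `2k`, `aMax3 ≤ k < bMin`. -/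
theorem dataRT_double_support (a b : Fin 4 → ℤ) :
    (dataRT a b).double.support ⊆ (Ico (aMax3 a) (bMin b)).image (fun k => 2 * k) :=
  support_sum_single_subset_image _ _ _

/-- All poles of the second-tale data. -/
theorem poles_dataRT (a b : Fin 4 → ℤ) : (dataRT a b).poles
    ⊆ (Ico (aMid a) (bMax b)).image (fun k => 2 * k) ∪ (Ico (aMax3 a) (bMin b)).image (fun k => 2 * k) :=
  union_subset_union (dataRT_simple_support a b) (dataRT_double_support a b)

end Summit.KontsevichZagierPeriods.Zeta5Search.FormalBarnes

namespace Summit.KontsevichZagierPeriods.Zeta5Search.TwoTaleOmega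

open Summit.KontsevichZagierPeriods.Zeta5Search.FormalBarnes

namespace Pt

variable (p : Pt)

/-! ### The hinge data: poles, double parts, degree -/

/-- `t1b 3 = g`. -/
theorem t1b_three : p.t1b 3 = p.g := rfl

/-- `t1a 3 = a`. -/
theorem t1a_three : p.t1a 3 = p.a := rfl

/-- `vL` has no double poles. -/
theorem vL_double : p.vL.double = 0 := by
  show (p.Pi)⁻¹ • (dataR p.t1a p.t1b).double = 0
  rw [dataR_double, smul_zero]

/-- The poles of `vL p` sit at `a₄*(t1a) ≤ k < g`. -/
theorem poles_vL : p.vL.poles ⊆ Ico (amax p.t1a) p.g :=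
  (PF.poles_smul_subset _ _).trans (poles_dataR _ _)

/-- The polynomial part of `vL p` is `Π⁻¹ · P`. -/
theorem vL_poly : p.vL.poly = C (p.Pi)⁻¹ * polyP p.t1a p.t1b := rfl

/-- Degree bound of the polynomial part of `vL p` (needs admissibility, as `natDegree_polyP_le`). -/
theorem vL_natDegree_le (h : Admissible p.t1a p.t1b) : p.vL.poly.natDegree ≤ dExp p.t1a p.t1b :=
  (natDegree_C_mul_le _ _).trans (natDegree_polyP_le h)

/-- `vR` has no polynomial part. -/
theorem vR_poly : p.vR.poly = 0 := by
  show C (p.eps * (p.Pi)⁻¹) * (dataRT p.t2a p.t2b).poly = 0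
  rw [dataRT_poly, mul_zero]

/-- The poles of `vR p` (in the `u = 2t` convention). -/
theorem poles_vR : p.vR.poles
    ⊆ (Ico (aMid p.t2a) (bMax p.t2b)).image (fun k => 2 * k) ∪ (Ico (aMax3 p.t2a) (bMin p.t2b)).image (fun k => 2 * k) :=
  (PF.poles_smul_subset _ _).trans (poles_dataRT _ _)

/-! ### The five lattice moves `p ↦ p + k·δ` -/

/-- Move along `δ_a`. -/
def addA (k : ℤ) : Pt := ⟨p.a + k, p.b, p.e, p.f, p.g⟩

/-- Move along `δ_b`. -/
def addB (k : ℤ) : Pt := ⟨p.a, p.b + k, p.e, p.f, p.g⟩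

/-- Move along `δ_e`. -/
def addE (k : ℤ) : Pt := ⟨p.a, p.b, p.e + k, p.f, p.g⟩

/-- Move along `δ_f`. -/
def addF (k : ℤ) : Pt := ⟨p.a, p.b, p.e, p.f + k, p.g⟩

/-- Move along `δ_g`. -/
def addG (k : ℤ) : Pt := ⟨p.a, p.b, p.e, p.f, p.g + k⟩

/-- The zero move. -/
theorem addB_zero : p.addB 0 = p := by cases p; simp [addB]

/-- Moves compose additively. -/
theorem addB_addB (k l : ℤ) : (p.addB k).addB l = p.addB (k + l) := by simp [addB, add_assoc]

/-- Along `δ_b` only the third first-tale numerator parameter moves: `t1a (p + k δ_b) = ![e, f, b + k, a]`. -/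
theorem t1a_addB (k : ℤ) : (p.addB k).t1a = ![p.e, p.f, p.b + k, p.a] := rfl

/-- Along `δ_b` the first-tale lower parameters do not move. -/
theorem t1b_addB (k : ℤ) : (p.addB k).t1b = p.t1b := rfl

/-- Along `δ_b`: `t2a (p + k δ_b) = ![g − (b+k) + a, f, e, a]`. -/
theorem t2a_addB (k : ℤ) : (p.addB k).t2a = ![p.g - (p.b + k) + p.a, p.f, p.e, p.a] := rfl

/-- Along `δ_b`: `t2b (p + k δ_b) = ![a + 1, a − (b+k) + 1, e + f, g]`. -/
theorem t2b_addB (k : ℤ) : (p.addB k).t2b = ![p.a + 1, p.a - (p.b + k) + 1, p.e + p.f, p.g] := rfl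

/-- Along `δ_b` the integer `d` grows by `k`. -/
theorem dInt_addB (k : ℤ) : (p.addB k).dInt = p.dInt + k := by simp [dInt, addB]; ring

end Pt

end Summit.KontsevichZagierPeriods.Zeta5Search.TwoTaleOmega
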